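import Mathlib
import HarnessLib
import Literature.MathematicalPhysics.QuantumLattice.GaugeGroups
import Summits.Ventures.LatticeQCDFlow.Exactness.WilsonOverrelaxation

/-!
# Haar measure on a compact group is two-sided and inversion invariant — the standing hypothesis of the local-update files, discharged

HONEST FRAMING: exact (Metropolis-corrected) sampling algorithms for lattice gauge theory;
figures of merit are autocorrelation/cost numbers at stated couplings and volumes; no
continuum-physics claim.

Venture `LatticeQCDFlow` (cell pub-lqcd), topic `Exactness`, FANOUT row 9 (eng-latcore).  NEW
WORK of the cell over Mathlib (`Measure.isMulInvariant_eq_smul_of_compactSpace`, Haar uniqueness on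
compact groups); nothing is cited as a fact.  Printed counterpart, named only: Folland, *A Course in
Abstract Harmonic Analysis* §2.4 (compact groups are unimodular).  Mathlib (at the pin) proves
right- and inversion-invariance of Haar measure only for ABELIAN groups
(`IsHaarMeasure.isInvInvariant_of_regular`); its `ModularCharacter.lean` leaves continuity of the
modular function as a TODO.  On a COMPACT group no continuity is needed: a right translate of a
Haar measure is a Haar measure of the same finite total mass, so the uniqueness constant is `1`.

`Overrelaxation.lean`, `LocalInvolution.lean`, `SymmetricMetropolis.lean` (random walks on a group),
`WilsonOverrelaxation.lean` all carry `[μ.IsMulLeftInvariant] [μ.IsMulRightInvariant]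
[μ.IsInvInvariant]` as hypotheses ("the Haar measure of a compact group").  This file makes them
instances for every Haar measure on a compact group, so those theorems apply to `SU(N)`, `U(N)`
with their normalised Haar measure `haarProbability` unconditionally.

## Content

* `isMulRightInvariant_of_isHaarMeasure_compactSpace` — a (left) Haar measure on a compact group
  is right invariant: `map (· * g) μ` is left invariant and finite on compacts, hence
  `= c • μ` (`isMulInvariant_eq_smul_of_compactSpace`); total masses agree (`μ univ ∈ (0, ∞)`),
  so `c = 1`.
* `isInvInvariant_of_isHaarMeasure_compactSpace` — … and inversion invariant: `μ.inv` is left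
  invariant (because `μ` is right invariant), finite, hence `= c • μ`, and `μ.inv univ = μ univ`.
* instances for `Literature.MathematicalPhysics.QuantumFieldTheory.haarProbability G`
  (`= haarMeasure ⊤`) on any compact group: `IsHaarMeasure`, `IsMulRightInvariant`,
  `IsInvInvariant`.
* **`haar_wilsonOverrelaxation_isReversible`** — over-relaxation of one SU(n) link, `g ↦ s g⁻¹ s`,
  is reversible for `e^{c Re tr (g (k s)ᴴ)} · haarProbability SU(n)` with NO invariance hypothesis
  left (the `N = 2` staple-sum hypothesis `R = k s` is `SU2StapleSum.lean`); `haar_measurePreserving_reflectThrough`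
  — the reflection preserves the Haar probability of any compact group.
-/

namespace Summit.Ventures.LatticeQCDFlow.Exactness

open MeasureTheory Measure ProbabilityTheory
open scoped ENNReal NNReal

section CompactGroup

variable {G : Type*} [TopologicalSpace G] [Group G] [IsTopologicalGroup G] [CompactSpace G]
  [MeasurableSpace G] [BorelSpace G]

/-- **Compact groups are unimodular**: a Haar measure on a compact group is right invariant. -/
theorem isMulRightInvariant_of_isHaarMeasure_compactSpace (μ : Measure G) [IsHaarMeasure μ] :
    μ.IsMulRightInvariant := by
  refine ⟨fun g => ?_⟩
  haveI : IsFiniteMeasureOnCompacts (map (· * g) μ) := ⟨fun K _ => measure_lt_top _ _⟩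
  set C : ℝ≥0 := haarScalarFactor (map (· * g) μ) μ
  have hC : map (· * g) μ = C • μ := isMulInvariant_eq_smul_of_compactSpace _ _
  suffices C = 1 by rw [hC, this, one_smul]
  have h : (C : ℝ≥0∞) * μ Set.univ = 1 * μ Set.univ := by
    rw [one_mul, ← smul_eq_mul, ← ENNReal.smul_def, ← Measure.smul_apply, ← hC,
      map_apply (measurable_mul_const g) MeasurableSet.univ, Set.preimage_univ]
  rwa [ENNReal.mul_left_inj (NeZero.ne _) (measure_ne_top _ _), ENNReal.coe_eq_one] at h

/-- **… and inversion invariant**: `μ(A⁻¹) = μ(A)` for a Haar measure on a compact group. -/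
theorem isInvInvariant_of_isHaarMeasure_compactSpace (μ : Measure G) [IsHaarMeasure μ] :
    μ.IsInvInvariant := by
  haveI := isMulRightInvariant_of_isHaarMeasure_compactSpace μ
  haveI : IsFiniteMeasure μ.inv := by rw [Measure.inv_def]; infer_instance
  haveI : IsFiniteMeasureOnCompacts μ.inv := ⟨fun K _ => measure_lt_top _ _⟩
  set C : ℝ≥0 := haarScalarFactor μ.inv μ
  have hC : μ.inv = C • μ := isMulInvariant_eq_smul_of_compactSpace _ _
  suffices C = 1 by exact ⟨by rw [hC, this, one_smul]⟩
  have h : (C : ℝ≥0∞) * μ Set.univ = 1 * μ Set.univ := by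
    rw [one_mul, ← smul_eq_mul, ← ENNReal.smul_def, ← Measure.smul_apply, ← hC, Measure.inv_apply, Set.inv_univ]
  rwa [ENNReal.mul_left_inj (NeZero.ne _) (measure_ne_top _ _), ENNReal.coe_eq_one] at h

/-! ### The normalised Haar measure `haarProbability G = haarMeasure ⊤` of a compact group -/

/-- `haarProbability G` is a Haar measure (it is `haarMeasure ⊤`). -/
instance haarProbability.instIsHaarMeasure :
    IsHaarMeasure (Literature.MathematicalPhysics.QuantumFieldTheory.haarProbability G) :=
  Measure.isHaarMeasure_haarMeasure ⊤

/-- `haarProbability G` is right invariant. -/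
instance haarProbability.instIsMulRightInvariant :
    (Literature.MathematicalPhysics.QuantumFieldTheory.haarProbability G).IsMulRightInvariant :=
  isMulRightInvariant_of_isHaarMeasure_compactSpace _

/-- `haarProbability G` is inversion invariant. -/
instance haarProbability.instIsInvInvariant :
    (Literature.MathematicalPhysics.QuantumFieldTheory.haarProbability G).IsInvInvariant :=
  isInvInvariant_of_isHaarMeasure_compactSpace _

/-- The over-relaxation reflection `g ↦ s g⁻¹ s` preserves the Haar probability of any compact group. -/
theorem haar_measurePreserving_reflectThrough (s : G) :
    MeasurePreserving (reflectThrough s)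
      (Literature.MathematicalPhysics.QuantumFieldTheory.haarProbability G)
      (Literature.MathematicalPhysics.QuantumFieldTheory.haarProbability G) :=
  measurePreserving_reflectThrough _ s

end CompactGroup

/-! ### SU(n): over-relaxation of one Wilson link is exact for the Haar-based link law, unconditionally -/

section SpecialUnitary

variable {n : Type*} [Fintype n] [DecidableEq n]

/-- **Over-relaxation of one SU(n) link is exact — no hypothesis left.**  With `μ` = the normalised
Haar measure of `SU(n)` the deterministic move `g ↦ s g⁻¹ s` is reversible with respect to
`e^{−wilsonLink c (k s)} μ = e^{c Re tr (g (k s)ᴴ)} μ` for every `c k : ℝ` and `s ∈ SU(n)` (the link law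
whose staple sum is `k s`; for `n = 2` every staple sum has this form, `SU2StapleSum.lean`). -/
theorem haar_wilsonOverrelaxation_isReversible (c k : ℝ) (s : Matrix.specialUnitaryGroup n ℂ) :
    Kernel.IsReversible
      (Kernel.deterministic (reflectThrough s)
        (haar_measurePreserving_reflectThrough (G := Matrix.specialUnitaryGroup n ℂ) s).measurable)
      ((Literature.MathematicalPhysics.QuantumFieldTheory.haarProbability
          (Matrix.specialUnitaryGroup n ℂ)).withDensity fun g => ENNReal.ofReal (Real.exp
        (-wilsonLink c ((k : ℂ) • (s : Matrix n n ℂ)) (g : Matrix n n ℂ)))) :=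
  wilsonOverrelaxation_isReversible _ c k s

/-- … and that link law is invariant under the move. -/
theorem haar_wilsonOverrelaxation_invariant (c k : ℝ) (s : Matrix.specialUnitaryGroup n ℂ) :
    Kernel.Invariant
      (Kernel.deterministic (reflectThrough s)
        (haar_measurePreserving_reflectThrough (G := Matrix.specialUnitaryGroup n ℂ) s).measurable)
      ((Literature.MathematicalPhysics.QuantumFieldTheory.haarProbability
          (Matrix.specialUnitaryGroup n ℂ)).withDensity fun g => ENNReal.ofReal (Real.exp
        (-wilsonLink c ((k : ℂ) • (s : Matrix n n ℂ)) (g : Matrix n n ℂ)))) :=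
  wilsonOverrelaxation_invariant _ c k s

/-- The same on `U(n)`. -/
theorem haar_unitaryWilsonOverrelaxation_isReversible (c k : ℝ) (s : Matrix.unitaryGroup n ℂ) :
    Kernel.IsReversible
      (Kernel.deterministic (reflectThrough s)
        (haar_measurePreserving_reflectThrough (G := Matrix.unitaryGroup n ℂ) s).measurable)
      ((Literature.MathematicalPhysics.QuantumFieldTheory.haarProbability
          (Matrix.unitaryGroup n ℂ)).withDensity fun g => ENNReal.ofReal (Real.exp
        (-wilsonLink c ((k : ℂ) • (s : Matrix n n ℂ)) (g : Matrix n n ℂ)))) :=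
  unitaryWilsonOverrelaxation_isReversible _ c k s

end SpecialUnitary

end Summit.Ventures.LatticeQCDFlow.Exactness
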